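import Mathlib.Analysis.CStarAlgebra.Matrix
import Literature.MathematicalPhysics.QuantumFieldTheory.SUNBakryEmeryPoincare
import Summits.Ventures.YMGap.Thresholds.LatticeBakryEmeryCalculus
import HarnessLib

/-!
# Venture YMGap — multi-link Bakry–Émery calculus, Part C1:
# the block frame of `𝔰𝔲(N)^E`, carré du champ, Laplacian and generator on `(E → M_N(ℂ))`

HONEST FRAMING: venture file (cell `pub-ymgap`, track (a), seat p2). Calculus plumbing towards a
kernel proof of the multi-link Bakry–Émery Poincaré inequality for lattice `SU(N)` Yang–Mills; no
physics in this file.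

The lattice configuration space `SU(N)^E` (finitely many links `E`) is a compact Lie group inside
the product algebra `𝔸 = (E → M_N(ℂ))`; its Lie algebra `𝔰𝔲(N)^E ⊂ 𝔸` has the **block frame**
`Y_{(e,α)} = single_e Y_α` built from the Parseval frame `(Y_α)` of `𝔰𝔲(N)` of the tree file
`SUNBakryEmeryFrame.lean`. With the left-invariant derivatives `D_A` of
`LatticeBakryEmeryCalculus.lean` (`algD`), we define, exactly as in the one-link file
`SUNBakryEmeryPoincare.lean` Part C,

* `Gam F G = ∑_{(e,α)} D_{(e,α)} F · D_{(e,α)} G` — the carré du champ of the product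
  Hilbert–Schmidt metric (`= ∑_e ⟨∇_e F, ∇_e G⟩`, Shen–Zhu–Zhu (3.7)),
* `Lap F = ∑_{(e,α)} D_{(e,α)} D_{(e,α)} F` — the Laplace–Beltrami operator of `SU(N)^E`,
* `genL S F = Lap F + Gam S F` — the Langevin generator of `e^{S} dσ^{⊗E}` (Shen–Zhu–Zhu (4.1)),

and prove: the reconstruction `D_X = ∑ ⟨Y_{(e,α)}, X⟩ D_{(e,α)}` for `X ∈ 𝔰𝔲(N)^E`, the
commutator expansion `[D_a, D_b] = ∑_c c_{abc} D_c` with BLOCK structure constants `c_{abc}`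
(those of `𝔰𝔲(N)` on the diagonal `e_a = e_b = e_c`, zero otherwise — still totally
antisymmetric), Leibniz rules, and `[Δ, D_a] = 0`.

## References

* H. Shen, R. Zhu, X. Zhu, CMP 400 (2023) 805–851 = arXiv:2204.12737, §2.2, (3.7), (4.1)–(4.3).
* Tree files `SUNBakryEmeryFrame.lean`, `SUNBakryEmeryPoincare.lean` (Part C).
-/

noncomputable section

open scoped Matrix ComplexConjugate BigOperators Matrix.Norms.Frobenius ContDiff Topology
open Matrix Complex Finset
open Literature.MathematicalPhysics.QuantumFieldTheory
open Literature.MathematicalPhysics.QuantumFieldTheory.SUNBakryEmery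
  (FrameIdx frame frame_conjTranspose frame_trace strC strC_swap12 strC_cycle strC_swap23 strC_swap13
   sum_re_trace_smul_frame conjTranspose_comm_of_skew trace_comm)

namespace Summit.Ventures.YMGap

namespace LatticeBakryEmery

universe u

variable {ι : Type u} [Fintype ι] [DecidableEq ι] {N : ℕ}

/-! ### The ambient algebra and the block frame -/

/-- The ambient algebra `𝔸 = (E → M_N(ℂ))` of lattice link configurations (product of matrix
algebras, pointwise product; under the scoped Frobenius norm a complete normed real algebra). -/
abbrev Cfg (ι : Type u) (N : ℕ) : Type u := ι → Matrix (Fin N) (Fin N) ℂ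

/-- The direction "`Y` in the link `e`": `single_e Y ∈ 𝔸`. -/
abbrev lk (e : ι) (Y : Matrix (Fin N) (Fin N) ℂ) : Cfg ι N := Pi.single e Y

/-- Index set of the block frame: a link and a one-link frame index. -/
abbrev BIdx (ι : Type u) (N : ℕ) : Type u := ι × FrameIdx N

/-- The **block frame** `Y_{(e,α)} = single_e Y_α` of `𝔰𝔲(N)^E ⊂ (E → M_N(ℂ))`. -/
def bframe (a : BIdx ι N) : Cfg ι N := lk a.1 (frame a.2)

omit [Fintype ι] in
/-- Components of the block frame. -/
theorem bframe_apply (a : BIdx ι N) (e : ι) : bframe (ι := ι) a e = if e = a.1 then frame a.2 else 0 := by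
  simp only [bframe, lk]
  by_cases h : e = a.1
  · subst h; simp
  · simp [h]

omit [Fintype ι] in
/-- `Q · single_e Y = single_e (Q_e Y)`: the left-invariant field generated by `single_e Y` moves
only the link `e`. -/
theorem mul_lk (Q : Cfg ι N) (e : ι) (Y : Matrix (Fin N) (Fin N) ℂ) : Q * lk e Y = lk e (Q e * Y) := by
  ext i : 1
  by_cases h : i = e
  · subst h; simp [lk]
  · simp [lk, h]

omit [Fintype ι] in
/-- Products of directions in different links vanish; in the same link they multiply. -/
theorem lk_mul_lk (e e' : ι) (Y Y' : Matrix (Fin N) (Fin N) ℂ) :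
    lk (ι := ι) e Y * lk e' Y' = if e = e' then lk e (Y * Y') else 0 := by
  ext i : 1
  by_cases h : e = e'
  · subst h
    by_cases hi : i = e
    · subst hi; simp [lk]
    · simp [lk, hi]
  · rw [if_neg h]
    by_cases hi : i = e
    · subst hi; simp [lk, h]
    · simp [lk, hi]

omit [Fintype ι] in
/-- The commutator of two block-frame directions: the `𝔰𝔲(N)` commutator in the common link,
zero across links. -/
theorem bframe_comm (a b : BIdx ι N) :
    bframe (ι := ι) a * bframe b - bframe b * bframe a =
      if a.1 = b.1 then lk a.1 (frame a.2 * frame b.2 - frame b.2 * frame a.2) else 0 := by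
  simp only [bframe, lk_mul_lk]
  by_cases h : a.1 = b.1
  · rw [if_pos h, if_pos h.symm, if_pos h, h]
    simp only [lk, ← Pi.single_sub]
  · rw [if_neg h, if_neg (Ne.symm h), if_neg h, sub_zero]

/-! ### The block Lie algebra `𝔰𝔲(N)^E` and reconstruction in the block frame -/

/-- The coefficient functional `⟨Y_{(e,α)}, X⟩ = -Re tr(Y_α X_e)` of the block frame. -/
def coef (a : BIdx ι N) (X : Cfg ι N) : ℝ := -(frame a.2 * X a.1).trace.re

omit [Fintype ι] in
/-- `single_e` commutes with finite sums. -/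
theorem lk_sum {κ : Type*} (s : Finset κ) (e : ι) (f : κ → Matrix (Fin N) (Fin N) ℂ) :
    lk (ι := ι) e (∑ k ∈ s, f k) = ∑ k ∈ s, lk e (f k) :=
  map_sum (AddMonoidHom.single (fun _ : ι => Matrix (Fin N) (Fin N) ℂ) e) f s

omit [Fintype ι] in
/-- `single_e (r • Y) = r • single_e Y` for real `r`. -/
theorem lk_smul (e : ι) (r : ℝ) (Y : Matrix (Fin N) (Fin N) ℂ) : lk (ι := ι) e (r • Y) = r • lk e Y := by
  ext i : 1
  by_cases h : i = e
  · subst h; simp [lk]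
  · simp [lk, h]

/-- **Reconstruction**: `X = ∑_{(e,α)} ⟨Y_{(e,α)}, X⟩ Y_{(e,α)}` for `X ∈ 𝔰𝔲(N)^E`. -/
theorem sum_coef_smul_bframe (hN : N ≠ 0) {X : Cfg ι N} (hX : ∀ e, (X e)ᴴ = -X e)
    (hX0 : ∀ e, (X e).trace = 0) : ∑ a : BIdx ι N, coef a X • bframe a = X := by
  rw [Fintype.sum_prod_type]
  have h : ∀ e : ι, ∑ α : FrameIdx N, coef (e, α) X • bframe (ι := ι) (e, α) = lk e (X e) := by
    intro e
    simp only [coef, bframe, ← lk_smul]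
    rw [← lk_sum, sum_re_trace_smul_frame hN (hX e) (hX0 e)]
  simp_rw [h]
  exact Finset.univ_sum_single X

section Calculus

/-- **`D_X = ∑_a ⟨Y_a, X⟩ D_{Y_a}`** for `X ∈ 𝔰𝔲(N)^E`. -/
theorem algD_eq_sum_bframe (hN : N ≠ 0) {X : Cfg ι N} (hX : ∀ e, (X e)ᴴ = -X e)
    (hX0 : ∀ e, (X e).trace = 0) (F : Cfg ι N → ℝ) (Q : Cfg ι N) :
    algD X F Q = ∑ a : BIdx ι N, coef a X * algD (bframe a) F Q := by
  conv_lhs => rw [← sum_coef_smul_bframe hN hX hX0]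
  exact algD_sum_smul_dir _ _ _ F Q

/-- `D` in the direction "`Y ∈ 𝔰𝔲(N)` in the link `e`" expanded in the block frame of that link. -/
theorem algD_lk_eq_sum (hN : N ≠ 0) (e : ι) {Y : Matrix (Fin N) (Fin N) ℂ} (hY : Yᴴ = -Y) (hY0 : Y.trace = 0)
    (F : Cfg ι N → ℝ) (Q : Cfg ι N) :
    algD (lk e Y) F Q = ∑ α : FrameIdx N, (-(frame α * Y).trace.re) * algD (bframe (e, α)) F Q := by
  conv_lhs => rw [← sum_re_trace_smul_frame hN hY hY0, lk_sum]
  simp only [lk_smul]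
  exact algD_sum_smul_dir _ _ _ F Q

/-! ### Block structure constants -/

/-- The **block structure constants** `c_{abc}`: the `𝔰𝔲(N)` structure constants when the three
indices lie in the same link, zero otherwise. -/
def bstrC (a b c : BIdx ι N) : ℝ := if a.1 = b.1 ∧ a.1 = c.1 then strC a.2 b.2 c.2 else 0

omit [Fintype ι] in
/-- `c_{abc} = -c_{bac}`. -/
theorem bstrC_swap12 (a b c : BIdx ι N) : bstrC a b c = -bstrC b a c := by
  unfold bstrC
  by_cases h1 : a.1 = b.1
  · by_cases h2 : a.1 = c.1
    · rw [if_pos ⟨h1, h2⟩, if_pos ⟨h1.symm, h1 ▸ h2⟩, strC_swap12]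
    · rw [if_neg (fun h => h2 h.2), if_neg (fun h => h2 (h1.trans h.2)), neg_zero]
  · rw [if_neg (fun h => h1 h.1), if_neg (fun h => h1 h.1.symm), neg_zero]

omit [Fintype ι] in
/-- `c_{abc} = -c_{acb}`. -/
theorem bstrC_swap23 (a b c : BIdx ι N) : bstrC a b c = -bstrC a c b := by
  unfold bstrC
  by_cases h1 : a.1 = b.1
  · by_cases h2 : a.1 = c.1
    · rw [if_pos ⟨h1, h2⟩, if_pos ⟨h2, h1⟩, strC_swap23]
    · rw [if_neg (fun h => h2 h.2), if_neg (fun h => h2 h.1), neg_zero]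
  · rw [if_neg (fun h => h1 h.1), if_neg (fun h => h1 h.2), neg_zero]

omit [Fintype ι] in
/-- `c_{abc} = -c_{cba}`. -/
theorem bstrC_swap13 (a b c : BIdx ι N) : bstrC a b c = -bstrC c b a := by
  unfold bstrC
  by_cases h1 : a.1 = b.1
  · by_cases h2 : a.1 = c.1
    · rw [if_pos ⟨h1, h2⟩, if_pos ⟨h2 ▸ h1, h2.symm⟩, strC_swap13]
    · rw [if_neg (fun h => h2 h.2), if_neg (fun h => h2 h.2.symm), neg_zero]
  · rw [if_neg (fun h => h1 h.1), if_neg (fun h => h1 (h.2.symm.trans h.1)), neg_zero]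

omit [DecidableEq ι] in
/-- A sum of an antisymmetric kernel against a symmetric one vanishes. -/
theorem sum_sum_eq_zero_of_antisymm {c m : BIdx ι N → BIdx ι N → ℝ} (hc : ∀ α γ, c α γ = -c γ α)
    (hm : ∀ α γ, m α γ = m γ α) : ∑ α, ∑ γ, c α γ * m α γ = 0 := by
  have h : ∑ α, ∑ γ, c α γ * m α γ = -∑ α, ∑ γ, c α γ * m α γ := by
    conv_rhs => rw [sum_comm]
    rw [← sum_neg_distrib]
    refine sum_congr rfl fun α _ => ?_
    rw [← sum_neg_distrib]
    refine sum_congr rfl fun γ _ => ?_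
    rw [hc γ α, hm γ α, neg_mul, neg_neg]
  linarith

/-- The commutator `[D_a, D_b]` expanded in the block frame: `D_a D_b F - D_b D_a F = ∑_c c_{abc} D_c F`. -/
theorem algD_algD_sub_eq_sum_bstrC (hN : N ≠ 0) {F : Cfg ι N → ℝ} (hF : ContDiff ℝ ∞ F)
    (a b : BIdx ι N) (Q : Cfg ι N) :
    algD (bframe a) (algD (bframe b) F) Q - algD (bframe b) (algD (bframe a) F) Q =
      ∑ c, bstrC a b c * algD (bframe c) F Q := by
  have h := congrFun (algD_comm hF (bframe a) (bframe b)) Q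
  rw [Pi.sub_apply] at h
  rw [h, bframe_comm]
  by_cases hab : a.1 = b.1
  · rw [if_pos hab, algD_lk_eq_sum hN a.1 (conjTranspose_comm_of_skew (frame_conjTranspose a.2)
      (frame_conjTranspose b.2)) (trace_comm _ _), Fintype.sum_prod_type]
    rw [Finset.sum_eq_single a.1]
    · refine sum_congr rfl fun γ _ => ?_
      simp [bstrC, hab, strC]
    · intro e _ he
      refine sum_eq_zero fun γ _ => ?_
      simp [bstrC, Ne.symm he]
    · intro h; exact absurd (mem_univ _) h
  · rw [if_neg hab]
    have h0 : algD (0 : Cfg ι N) F Q = 0 := by simp [algD]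
    rw [h0, eq_comm]
    refine sum_eq_zero fun c _ => ?_
    simp [bstrC, hab]

/-! ### Carré du champ, Laplacian, generator -/

/-- The **carré du champ** `Γ(F, G) = ∑_{(e,α)} D_{(e,α)} F D_{(e,α)} G = ∑_e ⟨∇_e F, ∇_e G⟩` of the
product Hilbert–Schmidt metric on `SU(N)^E` (Shen–Zhu–Zhu (3.7)). -/
def Gam (F G : Cfg ι N → ℝ) : Cfg ι N → ℝ :=
  fun Q => ∑ a : BIdx ι N, algD (bframe a) F Q * algD (bframe a) G Q

/-- The **Laplace–Beltrami operator** of `SU(N)^E` on ambient functions: `Δ F = ∑_a D_a D_a F`. -/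
def Lap (F : Cfg ι N → ℝ) : Cfg ι N → ℝ :=
  fun Q => ∑ a : BIdx ι N, algD (bframe a) (algD (bframe a) F) Q

/-- The **Langevin generator** `L_S F = Δ F + Γ(S, F)` of the measure `e^{S} dσ^{⊗E}`
(Shen–Zhu–Zhu (4.1)). -/
def genL (S F : Cfg ι N → ℝ) : Cfg ι N → ℝ :=
  fun Q => Lap F Q + Gam S F Q

/-- `Γ` is symmetric. -/
theorem Gam_comm (F G : Cfg ι N → ℝ) : Gam F G = Gam G F := by
  funext Q; simp only [Gam, mul_comm]

/-- `Γ(F, F) = ∑_a (D_a F)²`. -/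
theorem Gam_self_eq_sum_sq (F : Cfg ι N → ℝ) (Q : Cfg ι N) :
    Gam F F Q = ∑ a : BIdx ι N, algD (bframe a) F Q ^ 2 := by
  simp only [Gam, sq]

/-- `Γ(F, F) ≥ 0`. -/
theorem Gam_self_nonneg (F : Cfg ι N → ℝ) (Q : Cfg ι N) : 0 ≤ Gam F F Q := by
  rw [Gam_self_eq_sum_sq]; exact sum_nonneg fun a _ => sq_nonneg _

/-- **Cauchy–Schwarz for `Γ`**: `|Γ(F, G)| ≤ √Γ(F,F) √Γ(G,G)`. -/
theorem abs_Gam_le (F G : Cfg ι N → ℝ) (Q : Cfg ι N) :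
    |Gam F G Q| ≤ Real.sqrt (Gam F F Q) * Real.sqrt (Gam G G Q) := by
  rw [Gam_self_eq_sum_sq, Gam_self_eq_sum_sq, Gam]
  have h := Real.sum_mul_le_sqrt_mul_sqrt univ (fun a => algD (bframe a) F Q) (fun a => algD (bframe a) G Q)
  have h' := Real.sum_mul_le_sqrt_mul_sqrt univ (fun a => -algD (bframe a) F Q) (fun a => algD (bframe a) G Q)
  simp only [neg_mul, sum_neg_distrib, neg_sq] at h'
  exact abs_le.2 ⟨by linarith, h⟩

/-! #### Smoothness -/

/-- `Γ(F, G)` is smooth. -/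
theorem contDiff_Gam {F G : Cfg ι N → ℝ} (hF : ContDiff ℝ ∞ F) (hG : ContDiff ℝ ∞ G) :
    ContDiff ℝ ∞ (Gam F G) :=
  ContDiff.sum fun _ _ => (contDiff_algD hF _).mul (contDiff_algD hG _)

/-- `Δ F` is smooth. -/
theorem contDiff_Lap {F : Cfg ι N → ℝ} (hF : ContDiff ℝ ∞ F) : ContDiff ℝ ∞ (Lap F) :=
  ContDiff.sum fun _ _ => contDiff_algD (contDiff_algD hF _) _

/-- `L_S F` is smooth. -/
theorem contDiff_genL {S F : Cfg ι N → ℝ} (hS : ContDiff ℝ ∞ S) (hF : ContDiff ℝ ∞ F) :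
    ContDiff ℝ ∞ (genL S F) :=
  (contDiff_Lap hF).add (contDiff_Gam hS hF)

/-! #### Leibniz rules -/

/-- `Γ(F G, H) = F Γ(G, H) + G Γ(F, H)`. -/
theorem Gam_mul_left {F G H : Cfg ι N → ℝ} (hF : ContDiff ℝ ∞ F) (hG : ContDiff ℝ ∞ G)
    (Q : Cfg ι N) : Gam (F * G) H Q = F Q * Gam G H Q + G Q * Gam F H Q := by
  simp only [Gam, algD_mul hF hG, Pi.add_apply, Pi.mul_apply, mul_sum, ← sum_add_distrib]
  exact sum_congr rfl fun a _ => by ring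

/-- `Δ(F G) = F ΔG + G ΔF + 2 Γ(F, G)`. -/
theorem Lap_mul {F G : Cfg ι N → ℝ} (hF : ContDiff ℝ ∞ F) (hG : ContDiff ℝ ∞ G)
    (Q : Cfg ι N) : Lap (F * G) Q = F Q * Lap G Q + G Q * Lap F Q + 2 * Gam F G Q := by
  simp only [Lap, Gam]
  have h : ∀ a : BIdx ι N, algD (bframe a) (algD (bframe a) (F * G)) Q =
      F Q * algD (bframe a) (algD (bframe a) G) Q + G Q * algD (bframe a) (algD (bframe a) F) Q +
        2 * (algD (bframe a) F Q * algD (bframe a) G Q) := by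
    intro a
    rw [algD_mul hF hG, algD_add (F := F * algD (bframe a) G) (G := G * algD (bframe a) F)
      (hF.mul (contDiff_algD hG _)) (hG.mul (contDiff_algD hF _)),
      algD_mul hF (contDiff_algD hG _), algD_mul hG (contDiff_algD hF _)]
    simp only [Pi.add_apply, Pi.mul_apply]
    ring
  simp only [h, sum_add_distrib, ← mul_sum]

/-- **`L(FG) = F LG + G LF + 2Γ(F,G)`**. -/
theorem genL_mul {S F G : Cfg ι N → ℝ} (hF : ContDiff ℝ ∞ F) (hG : ContDiff ℝ ∞ G) (Q : Cfg ι N) :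
    genL S (F * G) Q = F Q * genL S G Q + G Q * genL S F Q + 2 * Gam F G Q := by
  rw [show genL S (F * G) Q = Lap (F * G) Q + Gam S (F * G) Q from rfl,
    show genL S G Q = Lap G Q + Gam S G Q from rfl, show genL S F Q = Lap F Q + Gam S F Q from rfl,
    Lap_mul hF hG, Gam_comm S (F * G), Gam_mul_left hF hG, Gam_comm G S, Gam_comm F S]
  ring

/-! #### The Casimir commutes with left-invariant derivatives -/

/-- **`[Δ, D_a] = 0`**: `∑_b D_b D_b D_a F = D_a Δ F` (total antisymmetry of the block structure
constants). -/
theorem sum_algD_algD_algD_eq_algD_Lap (hN : N ≠ 0) {F : Cfg ι N → ℝ} (hF : ContDiff ℝ ∞ F)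
    (a : BIdx ι N) (Q : Cfg ι N) :
    ∑ b, algD (bframe b) (algD (bframe b) (algD (bframe a) F)) Q = algD (bframe a) (Lap F) Q := by
  have hLap : algD (bframe a) (Lap F) Q = ∑ b, algD (bframe a) (algD (bframe b) (algD (bframe b) F)) Q :=
    congrFun (algD_sum univ (F := fun b => algD (bframe b) (algD (bframe b) F))
      (fun b _ => contDiff_algD (contDiff_algD hF _) _) (bframe a)) Q
  rw [hLap, ← sub_eq_zero, ← sum_sub_distrib]
  have htel : ∀ b : BIdx ι N,
      algD (bframe b) (algD (bframe b) (algD (bframe a) F)) Q - algD (bframe a) (algD (bframe b) (algD (bframe b) F)) Q =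
        ∑ c, bstrC b a c * (algD (bframe b) (algD (bframe c) F) Q + algD (bframe c) (algD (bframe b) F) Q) := by
    intro b
    have e1 : algD (bframe b) (algD (bframe b) (algD (bframe a) F)) Q -
        algD (bframe b) (algD (bframe a) (algD (bframe b) F)) Q
        = ∑ c, bstrC b a c * algD (bframe b) (algD (bframe c) F) Q := by
      have hfun : algD (bframe b) (algD (bframe a) F) - algD (bframe a) (algD (bframe b) F) =
          fun Q => ∑ c, bstrC b a c * algD (bframe c) F Q :=
        funext fun Q => algD_algD_sub_eq_sum_bstrC hN hF b a Q
      have hsub := congrFun (algD_sub (F := algD (bframe b) (algD (bframe a) F))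
        (G := algD (bframe a) (algD (bframe b) F)) (contDiff_algD (contDiff_algD hF _) _)
        (contDiff_algD (contDiff_algD hF _) _) (bframe b)) Q
      rw [Pi.sub_apply] at hsub
      rw [← hsub, hfun, algD_sum univ (F := fun c Q => bstrC b a c * algD (bframe c) F Q)
        (fun c _ => contDiff_const.mul (contDiff_algD hF _))]
      refine sum_congr rfl fun c _ => ?_
      rw [algD_const_mul (contDiff_algD hF _)]
    have e2 : algD (bframe b) (algD (bframe a) (algD (bframe b) F)) Q -
        algD (bframe a) (algD (bframe b) (algD (bframe b) F)) Q
        = ∑ c, bstrC b a c * algD (bframe c) (algD (bframe b) F) Q :=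
      algD_algD_sub_eq_sum_bstrC hN (contDiff_algD hF _) b a Q
    calc _ = (algD (bframe b) (algD (bframe b) (algD (bframe a) F)) Q -
              algD (bframe b) (algD (bframe a) (algD (bframe b) F)) Q)
          + (algD (bframe b) (algD (bframe a) (algD (bframe b) F)) Q -
              algD (bframe a) (algD (bframe b) (algD (bframe b) F)) Q) := by ring
      _ = _ := by rw [e1, e2, ← sum_add_distrib]; exact sum_congr rfl fun c _ => by ring
  simp_rw [htel]
  exact sum_sum_eq_zero_of_antisymm (fun b c => bstrC_swap13 b a c) fun b c => by ring

end Calculus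

end LatticeBakryEmery

end Summit.Ventures.YMGap
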